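import Mathlib
import HarnessLib
import Literature.Computability.AlgebraicComplexity.StrassenSpectralTheorem
import Literature.Computability.AlgebraicComplexity.TensorSemiringSpectrum
import Literature.Computability.AlgebraicComplexity.AsymptoticRankBorderRank
import Summits.MatrixMultiplication.MatrixMultiplication.Theorems.OutsiderSandwichBlockOneTransfer
import Summits.MatrixMultiplication.MatrixMultiplication.Theorems.OutsiderSandwichBlockOneRank

/-!
# Outsider sandwich — the one-block leaf in OPERATIONAL form (decomp-mm lens-4, g19)

Route `route-MatrixMultiplication-OutsiderSandwich` (cut of record `LaserTangency ∧ LaserMergeOptimal ∧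
SummitIffLaserTangency`, unchanged); items `BlockOneIsMM` (27147, ω-free, NECESSARY), `BlockBelowMM`
(27150, ω-free), `BlockRankLeFour` (28539), `CouplingMergeOptimal` (28193, residual); registered line
`Cruxes/LaserTangency/Lines/block_one_transfer.lean` (only open stub `stub_blockOneAsymptoticRestriction`).
`C₁ = coupling₁` is the explicit free tight `4 × 4 × 4` coupled block of `cw₂ ⊗ cw₂`.

## What this file proves (all hypothesis-free)

§1 A general DICTIONARY over any field `K` (Strassen's spectral theorem, in the tree as
`IsStrassenPreorder.asympLe_iff_forall_spectralPoint` + `TensorClass.isStrassenPreorder`):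
for finite tensors `s, t`,
`(∀ universal F, F s ≤ F t) ⟺ [s] ≲ [t] in T(K) ⟺ ∃ f subexponential, ∀ N, ⟨f N⟩ ⊠ t^{⊠N} ⊵ s^{⊠N}`
`⟺ ∀ ε > 0, for cofinally many N, ∃ B ≤ 2^{εN}, ⟨B⟩ ⊠ t^{⊠N} ⊵ s^{⊠N}`
(`forall_universal_le_iff_asympLe`, `asympLe_mk_iff_helped`, `forall_universal_le_iff_helped`,
`forall_universal_le_iff_cofinal`).

§2 The r-direction (`s = ⟨2,2,2⟩`, `t = C₁`): the registered line's load-bearing stub is EQUIVALENT to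
the item it serves — `blockOneIsMM_iff_asymptoticRestriction : BlockOneIsMM ⟺ stub₁-statement` — hence
the stub statement is NECESSARY for `ω = 2` (`asymptoticRestriction_of_summit`) and the cut is exact in
operational form: `ω = 2 ⟺ stub₁-statement ∧ CouplingMergeOptimal`
(`summit_iff_asymptoticRestriction_and_couplingMergeOptimal`).  So the attacked leaf of the β-reading is
an explicit existence-of-restriction-matrices statement about 0/1 tensors, degree by degree, with no
quantifier over unknown spectral points and no `ω`.

§3 The s-direction (`s = C₁`, `t = ⟨2,2,2⟩`): `BlockBelowMM` has the same operational form
(`blockBelowMM_iff_helped`, `blockBelowMM_iff_cofinal`); `BlockRankLeFour ⟹ BlockBelowMM`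
(`blockBelowMM_of_blockRankLeFour`), and the DOOR IDENTITY
`BlockRankLeFour ⟺ (ω = 2 ∧ BlockBelowMM) ⟺ R̃(C₁) = 4` (`blockRankLeFour_iff_summit_and_blockBelowMM`,
`asymptoticRank_coupling₁_eq_four_iff`): Strassen's asymptotic-rank conjecture for the single explicit
tensor `C₁` is exactly the summit plus the ω-free aside `BlockBelowMM`.

§4 Datum: `R̃(C₁) ≤ 6` (border rank `6`, tree `algBorderRank_coupling₁`, and `R̃ ≤ R̲`), sharpening the
tree's `R̃(C₁) ≤ 7`; so `R̃(C₁) ∈ [4, 6]` and the door asks whether it is `4`.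

[Strassen1988, Thm. 3.8]; [Zuiddam2018, Thm. 2.12, §2.3]; [ChristandlVranaZuiddam2023, §1.1–1.2];
[BurgisserClausenShokrollahi1997, Lemma (15.27), §15.6]; [CoppersmithWinograd1990, §7].
-/

noncomputable section

open Filter Topology
open Literature.Computability.AlgebraicComplexity
open Summit.MatrixMultiplication.MatrixMultiplication.Theorems.OutsiderSandwichCoupling (coupling₁ coupling₂ coupling₃)

namespace Summit.MatrixMultiplication.MatrixMultiplication.Theorems.OutsiderSandwichBlockOneOperational

universe u

/-! ## 1. Dictionary: spectral domination ⟺ sub-exponentially helped restriction of powers -/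

section Dictionary

variable {K : Type u} [Field K]
variable {ι κ μ ι' κ' μ' : Type} [Fintype ι] [Fintype κ] [Fintype μ] [Fintype ι'] [Fintype κ']
  [Fintype μ']

/-- **Spectral domination is the asymptotic preorder of `T(K)`** (Strassen's spectral theorem):
`F s ≤ F t` for every universal spectral point `F` iff `[s] ≲ [t]`. [cite: Zuiddam2018, Thm. 2.12] -/
theorem forall_universal_le_iff_asympLe (s : ι → κ → μ → K) (t : ι' → κ' → μ' → K) :
    (∀ F : SpectralMap K, IsUniversalSpectralPoint K F → F s ≤ F t) ↔
      AsympLe (fun x y : TensorClass K => x ≤ y) (TensorClass.mk s) (TensorClass.mk t) := by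
  rw [(TensorClass.isStrassenPreorder K).asympLe_iff_forall_spectralPoint]
  constructor
  · intro H φ hφ
    have h := H _ (TensorClass.isUniversalSpectralPoint_spectralMapOf hφ)
    rwa [TensorClass.spectralMapOf_apply, TensorClass.spectralMapOf_apply] at h
  · intro H F hF
    have h := H _ (TensorClass.isSpectralPoint_eval hF)
    rwa [TensorClass.eval_mk hF, TensorClass.eval_mk hF] at h

/-- **`[s] ≲ [t]` unpacked**: a subexponential `f` with `⟨f N⟩ ⊠ t^{⊠N} ⊵ s^{⊠N}` for every `N`.
[cite: Zuiddam2018, Def. 2.1, §2.3] -/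
theorem asympLe_mk_iff_helped (s : ι → κ → μ → K) (t : ι' → κ' → μ' → K) :
    AsympLe (fun x y : TensorClass K => x ≤ y) (TensorClass.mk s) (TensorClass.mk t) ↔
      ∃ f : ℕ → ℕ, IsSubexponential f ∧ ∀ N : ℕ,
        TensorRestrictsTo (kroneckerTensor (unitTensor K (f N)) (kroneckerPow t N))
          (kroneckerPow s N) := by
  refine exists_congr fun f => and_congr Iff.rfl (forall_congr' fun N => ?_)
  dsimp only
  rw [TensorClass.mk_pow s N, TensorClass.mk_pow t N, TensorClass.natCast_eq_mk (f N),
    TensorClass.mk_mul_mk, TensorClass.mk_le_mk_iff]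

/-- **Spectral domination ⟺ helped restriction of all powers.** [cite: Strassen1988, Thm. 3.8] -/
theorem forall_universal_le_iff_helped (s : ι → κ → μ → K) (t : ι' → κ' → μ' → K) :
    (∀ F : SpectralMap K, IsUniversalSpectralPoint K F → F s ≤ F t) ↔
      ∃ f : ℕ → ℕ, IsSubexponential f ∧ ∀ N : ℕ,
        TensorRestrictsTo (kroneckerTensor (unitTensor K (f N)) (kroneckerPow t N))
          (kroneckerPow s N) :=
  (forall_universal_le_iff_asympLe s t).trans (asympLe_mk_iff_helped s t)

/-- From a subexponential help function to the COFINAL `2^{εN}` form: if `P N (f N)` for all `N` with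
`f` subexponential, then for every `ε > 0` and cofinally many `N` some `B ≤ 2^{εN}` has `P N B`
(namely `B = f N`). [folklore] -/
theorem cofinal_of_subexponential {P : ℕ → ℕ → Prop} {f : ℕ → ℕ} (hf : IsSubexponential f)
    (hP : ∀ N, P N (f N)) :
    ∀ ε : ℝ, 0 < ε → ∀ N₀ : ℕ, ∃ N : ℕ, N₀ ≤ N ∧ ∃ B : ℕ, P N B ∧ (B : ℝ) ≤ (2 : ℝ) ^ (ε * N) := by
  intro ε hε N₀
  set q : ℝ := (2 : ℝ) ^ (ε / 2) with hq
  have hq1 : 1 < q := Real.one_lt_rpow (by norm_num) (by positivity)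
  have hq0 : 0 ≤ q := by linarith
  obtain ⟨C, hC⟩ := hf (q - 1) (by linarith)
  have hC' : ∀ N, (f N : ℝ) ≤ C * q ^ N := fun N => by
    simpa [show (1 : ℝ) + (q - 1) = q by ring] using hC N
  obtain ⟨N, hN₀, hCN⟩ : ∃ N, N₀ ≤ N ∧ C ≤ q ^ N := by
    have h1 := (tendsto_pow_atTop_atTop_of_one_lt hq1).eventually_ge_atTop C
    obtain ⟨N, hN⟩ := ((eventually_ge_atTop N₀).and h1).exists
    exact ⟨N, hN.1, hN.2⟩
  refine ⟨N, hN₀, f N, hP N, ?_⟩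
  calc (f N : ℝ) ≤ C * q ^ N := hC' N
    _ ≤ q ^ N * q ^ N := mul_le_mul_of_nonneg_right hCN (pow_nonneg hq0 N)
    _ = (2 : ℝ) ^ (ε * N) := by
      rw [← mul_pow, hq, ← Real.rpow_add (by norm_num : (0 : ℝ) < 2), add_halves,
        Real.rpow_mul_natCast (by norm_num : (0 : ℝ) ≤ 2)]

/-- **The cofinal `2^{εN}` form implies spectral domination**: apply `F`, take `N`-th roots, let
`ε → 0⁺` (the general form of `OutsiderSandwichBlockOneTransfer.blockOneIsMM_of_asymptoticRestriction`).
[cite: ChristandlVranaZuiddam2023, §1.1] -/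
theorem forall_universal_le_of_cofinal (s : ι → κ → μ → K) (t : ι' → κ' → μ' → K)
    (h : ∀ ε : ℝ, 0 < ε → ∀ N₀ : ℕ, ∃ N : ℕ, N₀ ≤ N ∧ ∃ B : ℕ,
      TensorRestrictsTo (kroneckerTensor (unitTensor K B) (kroneckerPow t N)) (kroneckerPow s N) ∧
        (B : ℝ) ≤ (2 : ℝ) ^ (ε * N)) :
    ∀ F : SpectralMap K, IsUniversalSpectralPoint K F → F s ≤ F t := by
  intro F hF
  have hs0 : 0 ≤ F s := hF.nonneg _
  have ht0 : 0 ≤ F t := hF.nonneg _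
  have key : ∀ ε : ℝ, 0 < ε → F s ≤ (2 : ℝ) ^ ε * F t := by
    intro ε hε
    obtain ⟨N, hN, B, hres, hB⟩ := h ε hε 1
    have hN0 : N ≠ 0 := by omega
    have hm := hF.mono _ _ hres
    rw [hF.map_kronecker, hF.map_kroneckerPow, hF.map_kroneckerPow,
      ← TensorClass.evalRingHom_mk hF (unitTensor K B), ← TensorClass.natCast_eq_mk, map_natCast] at hm
    -- `hm : F s ^ N ≤ B * F t ^ N`
    have e2 : (2 : ℝ) ^ (ε * N) = ((2 : ℝ) ^ ε) ^ N := Real.rpow_mul_natCast (by norm_num) _ _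
    rw [e2] at hB
    have htN : 0 ≤ F t ^ N := pow_nonneg ht0 N
    have hpow : F s ^ N ≤ ((2 : ℝ) ^ ε * F t) ^ N :=
      calc F s ^ N ≤ (B : ℝ) * F t ^ N := hm
        _ ≤ ((2 : ℝ) ^ ε) ^ N * F t ^ N := mul_le_mul_of_nonneg_right hB htN
        _ = ((2 : ℝ) ^ ε * F t) ^ N := by rw [mul_pow]
    exact le_of_pow_le_pow_left₀ hN0 (by positivity) hpow
  have hlim : Tendsto (fun ε : ℝ => (2 : ℝ) ^ ε * F t) (𝓝[>] 0) (𝓝 ((2 : ℝ) ^ (0 : ℝ) * F t)) := by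
    have hc : ContinuousAt (fun x : ℝ => (2 : ℝ) ^ x) 0 := Real.continuousAt_const_rpow (by norm_num)
    exact (hc.tendsto.mono_left nhdsWithin_le_nhds).mul_const _
  rw [Real.rpow_zero, one_mul] at hlim
  refine ge_of_tendsto hlim ?_
  filter_upwards [self_mem_nhdsWithin] with ε hε using key ε hε

/-- **Spectral domination ⟺ the cofinal `2^{εN}` form** (the shape of the registered stub).
[cite: Strassen1988, Thm. 3.8] -/
theorem forall_universal_le_iff_cofinal (s : ι → κ → μ → K) (t : ι' → κ' → μ' → K) :
    (∀ F : SpectralMap K, IsUniversalSpectralPoint K F → F s ≤ F t) ↔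
      ∀ ε : ℝ, 0 < ε → ∀ N₀ : ℕ, ∃ N : ℕ, N₀ ≤ N ∧ ∃ B : ℕ,
        TensorRestrictsTo (kroneckerTensor (unitTensor K B) (kroneckerPow t N)) (kroneckerPow s N) ∧
          (B : ℝ) ≤ (2 : ℝ) ^ (ε * N) := by
  refine ⟨fun H => ?_, forall_universal_le_of_cofinal s t⟩
  obtain ⟨f, hf, hP⟩ := (forall_universal_le_iff_helped s t).1 H
  exact cofinal_of_subexponential (P := fun N B =>
    TensorRestrictsTo (kroneckerTensor (unitTensor K B) (kroneckerPow t N)) (kroneckerPow s N)) hf hP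

/-- The cofinal form with ALL large `N` (not just cofinally many) also follows. [folklore] -/
theorem eventually_helped_of_forall_universal_le (s : ι → κ → μ → K) (t : ι' → κ' → μ' → K)
    (H : ∀ F : SpectralMap K, IsUniversalSpectralPoint K F → F s ≤ F t) :
    ∀ ε : ℝ, 0 < ε → ∃ N₀ : ℕ, ∀ N : ℕ, N₀ ≤ N → ∃ B : ℕ,
      TensorRestrictsTo (kroneckerTensor (unitTensor K B) (kroneckerPow t N)) (kroneckerPow s N) ∧
        (B : ℝ) ≤ (2 : ℝ) ^ (ε * N) := by
  intro ε hε
  obtain ⟨f, hf, hP⟩ := (forall_universal_le_iff_helped s t).1 H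
  set q : ℝ := (2 : ℝ) ^ (ε / 2) with hq
  have hq1 : 1 < q := Real.one_lt_rpow (by norm_num) (by positivity)
  have hq0 : 0 ≤ q := by linarith
  obtain ⟨C, hC⟩ := hf (q - 1) (by linarith)
  have hC' : ∀ N, (f N : ℝ) ≤ C * q ^ N := fun N => by
    simpa [show (1 : ℝ) + (q - 1) = q by ring] using hC N
  obtain ⟨N₀, hN₀⟩ := ((tendsto_pow_atTop_atTop_of_one_lt hq1).eventually_ge_atTop C).exists_forall_of_atTop
  refine ⟨N₀, fun N hN => ⟨f N, hP N, ?_⟩⟩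
  calc (f N : ℝ) ≤ C * q ^ N := hC' N
    _ ≤ q ^ N * q ^ N := mul_le_mul_of_nonneg_right (hN₀ N hN) (pow_nonneg hq0 N)
    _ = (2 : ℝ) ^ (ε * N) := by
      rw [← mul_pow, hq, ← Real.rpow_add (by norm_num : (0 : ℝ) < 2), add_halves,
        Real.rpow_mul_natCast (by norm_num : (0 : ℝ) ≤ 2)]

end Dictionary

/-! ## 2. The r-direction: `BlockOneIsMM` ⟺ the registered stub's statement -/

/-- **`BlockOneIsMM ⟺ [⟨2,2,2⟩] ≲ [C₁]` with an explicit subexponential help function.**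
[cite: Strassen1988, Thm. 3.8] -/
theorem blockOneIsMM_iff_helped :
    Theses.OutsiderSandwich.BlockOneIsMM ↔
      ∃ f : ℕ → ℕ, IsSubexponential f ∧ ∀ N : ℕ,
        TensorRestrictsTo (kroneckerTensor (unitTensor ℂ (f N)) (kroneckerPow coupling₁ N))
          (kroneckerPow (matMulTensor ℂ 2 2 2) N) :=
  OutsiderSandwichBlockOneItems.blockOneIsMM_iff.trans
    (forall_universal_le_iff_helped (matMulTensor ℂ 2 2 2) coupling₁)

/-- **`BlockOneIsMM ⟺ stub_blockOneAsymptoticRestriction`** (the registered line's load-bearing stub,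
verbatim): the stub is EQUIVALENT to the item it serves, not merely sufficient.
[cite: Strassen1988, Thm. 3.8] -/
theorem blockOneIsMM_iff_asymptoticRestriction :
    Theses.OutsiderSandwich.BlockOneIsMM ↔
      ∀ ε : ℝ, 0 < ε → ∀ N₀ : ℕ, ∃ N : ℕ, N₀ ≤ N ∧ ∃ B : ℕ,
        TensorRestrictsTo (kroneckerTensor (unitTensor ℂ B) (kroneckerPow coupling₁ N))
          (kroneckerPow (matMulTensor ℂ 2 2 2) N) ∧ (B : ℝ) ≤ (2 : ℝ) ^ (ε * N) :=
  OutsiderSandwichBlockOneItems.blockOneIsMM_iff.trans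
    (forall_universal_le_iff_cofinal (matMulTensor ℂ 2 2 2) coupling₁)

/-- **The stub statement is NECESSARY for `ω = 2`.** -/
theorem asymptoticRestriction_of_summit (hS : _root_.MatrixMultiplication) :
    ∀ ε : ℝ, 0 < ε → ∀ N₀ : ℕ, ∃ N : ℕ, N₀ ≤ N ∧ ∃ B : ℕ,
      TensorRestrictsTo (kroneckerTensor (unitTensor ℂ B) (kroneckerPow coupling₁ N))
        (kroneckerPow (matMulTensor ℂ 2 2 2) N) ∧ (B : ℝ) ≤ (2 : ℝ) ^ (ε * N) :=
  blockOneIsMM_iff_asymptoticRestriction.1 (OutsiderSandwichBlockOneItems.blockOneIsMM_of_summit_items hS)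

/-- **`ω = 2` gives the restriction for ALL large `N`** (not only cofinally many). -/
theorem eventually_asymptoticRestriction_of_summit (hS : _root_.MatrixMultiplication) :
    ∀ ε : ℝ, 0 < ε → ∃ N₀ : ℕ, ∀ N : ℕ, N₀ ≤ N → ∃ B : ℕ,
      TensorRestrictsTo (kroneckerTensor (unitTensor ℂ B) (kroneckerPow coupling₁ N))
        (kroneckerPow (matMulTensor ℂ 2 2 2) N) ∧ (B : ℝ) ≤ (2 : ℝ) ^ (ε * N) :=
  eventually_helped_of_forall_universal_le (matMulTensor ℂ 2 2 2) coupling₁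
    (OutsiderSandwichBlockOneItems.blockOneIsMM_iff.1
      (OutsiderSandwichBlockOneItems.blockOneIsMM_of_summit_items hS))

/-- **The exact cut in operational form: `ω = 2 ⟺ stub-statement ∧ CouplingMergeOptimal`.** -/
theorem summit_iff_asymptoticRestriction_and_couplingMergeOptimal :
    _root_.MatrixMultiplication ↔
      (∀ ε : ℝ, 0 < ε → ∀ N₀ : ℕ, ∃ N : ℕ, N₀ ≤ N ∧ ∃ B : ℕ,
        TensorRestrictsTo (kroneckerTensor (unitTensor ℂ B) (kroneckerPow coupling₁ N))
          (kroneckerPow (matMulTensor ℂ 2 2 2) N) ∧ (B : ℝ) ≤ (2 : ℝ) ^ (ε * N)) ∧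
      Theses.OutsiderSandwich.CouplingMergeOptimal :=
  OutsiderSandwichBlockOneItems.summit_iff_blockOneIsMM_items.trans
    (and_congr blockOneIsMM_iff_asymptoticRestriction Iff.rfl)

/-! ## 3. The s-direction: `BlockBelowMM` operationally, and the door identity -/

/-- **`BlockBelowMM ⟺ [C₁] ≲ [⟨2,2,2⟩]` with an explicit subexponential help function.**
[cite: Strassen1988, Thm. 3.8] -/
theorem blockBelowMM_iff_helped :
    Theses.OutsiderSandwich.BlockBelowMM ↔
      ∃ f : ℕ → ℕ, IsSubexponential f ∧ ∀ N : ℕ,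
        TensorRestrictsTo (kroneckerTensor (unitTensor ℂ (f N)) (kroneckerPow (matMulTensor ℂ 2 2 2) N))
          (kroneckerPow coupling₁ N) :=
  OutsiderSandwichBlockOneItems.blockBelowMM_iff.trans
    (forall_universal_le_iff_helped coupling₁ (matMulTensor ℂ 2 2 2))

/-- **`BlockBelowMM ⟺` the cofinal `2^{εN}` form** (`⟨B⟩ ⊠ ⟨2^N,2^N,2^N⟩ ⊵ C₁^{⊠N}`, `B ≤ 2^{εN}`).
[cite: Strassen1988, Thm. 3.8] -/
theorem blockBelowMM_iff_cofinal :
    Theses.OutsiderSandwich.BlockBelowMM ↔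
      ∀ ε : ℝ, 0 < ε → ∀ N₀ : ℕ, ∃ N : ℕ, N₀ ≤ N ∧ ∃ B : ℕ,
        TensorRestrictsTo (kroneckerTensor (unitTensor ℂ B) (kroneckerPow (matMulTensor ℂ 2 2 2) N))
          (kroneckerPow coupling₁ N) ∧ (B : ℝ) ≤ (2 : ℝ) ^ (ε * N) :=
  OutsiderSandwichBlockOneItems.blockBelowMM_iff.trans
    (forall_universal_le_iff_cofinal coupling₁ (matMulTensor ℂ 2 2 2))

/-- **`BlockRankLeFour ⟹ BlockBelowMM`**: `F(C₁) ≤ R̃(C₁) ≤ 4 ≤ F⟨2,2,2⟩` at every universal point.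
[cite: Strassen1988, Thm. 3.8] -/
theorem blockBelowMM_of_blockRankLeFour (h : Theses.OutsiderSandwich.BlockRankLeFour) :
    Theses.OutsiderSandwich.BlockBelowMM := by
  have h₁ : asymptoticRank coupling₁ ≤ 4 := (OutsiderSandwichBlockItems.blockRankLeFour_iff.1 h).1
  refine OutsiderSandwichBlockOneItems.blockBelowMM_iff.2 fun F hF => ?_
  exact (((strassen_duality_asymptoticRank_holds ℂ coupling₁).1 F hF).trans h₁).trans
    (OutsiderSandwichEdgeRigidity.four_le_map_matMulTensor_two hF)

/-- **The door identity: `BlockRankLeFour ⟺ (ω = 2 ∧ BlockBelowMM)`.**  (`⟹ ω = 2` is the tree's door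
`summit_of_blockRankLeFour` with the proved `CouplingBenchmark`; `⟸` is `BlockBelowMM ⟹ (ω = 2 ⟺
BlockRankLeFour)`.) -/
theorem blockRankLeFour_iff_summit_and_blockBelowMM :
    Theses.OutsiderSandwich.BlockRankLeFour ↔
      (_root_.MatrixMultiplication ∧ Theses.OutsiderSandwich.BlockBelowMM) := by
  constructor
  · intro h
    have hB := blockBelowMM_of_blockRankLeFour h
    exact ⟨(OutsiderSandwichBlockOneItems.summit_iff_blockRankLeFour_of_blockBelowMM hB).2 h, hB⟩
  · rintro ⟨hS, hB⟩
    exact (OutsiderSandwichBlockOneItems.summit_iff_blockRankLeFour_of_blockBelowMM hB).1 hS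

/-- **`R̃(C₁) = 4 ⟺ (ω = 2 ∧ BlockBelowMM)`**: Strassen's asymptotic rank conjecture for the one explicit
tensor `C₁` is exactly the summit plus the ω-free aside. -/
theorem asymptoticRank_coupling₁_eq_four_iff :
    asymptoticRank coupling₁ = 4 ↔ (_root_.MatrixMultiplication ∧ Theses.OutsiderSandwich.BlockBelowMM) := by
  rw [← blockRankLeFour_iff_summit_and_blockBelowMM, OutsiderSandwichBlockItems.blockRankLeFour_iff]
  have h4 := OutsiderSandwichBlockRank.four_le_asymptoticRank_coupling₁
  constructor
  · intro h
    have h₁ : asymptoticRank coupling₁ ≤ 4 := h.le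
    exact ⟨h₁, OutsiderSandwichCouplingBenchmark.asymptoticRank_coupling₂.trans_le h₁,
      OutsiderSandwichCouplingBenchmark.asymptoticRank_coupling₃.trans_le h₁⟩
  · intro h
    exact le_antisymm h.1 h4

/-- **`¬ BlockBelowMM ⟹ R̃(C₁) > 4`** (an explicit counterexample to the asymptotic rank conjecture). -/
theorem four_lt_asymptoticRank_coupling₁_of_not_blockBelowMM (h : ¬ Theses.OutsiderSandwich.BlockBelowMM) :
    4 < asymptoticRank coupling₁ := by
  by_contra hle
  have h₁ : asymptoticRank coupling₁ ≤ 4 := not_lt.1 hle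
  exact h (blockBelowMM_of_blockRankLeFour (OutsiderSandwichBlockItems.blockRankLeFour_iff.2
    ⟨h₁, OutsiderSandwichCouplingBenchmark.asymptoticRank_coupling₂.trans_le h₁,
      OutsiderSandwichCouplingBenchmark.asymptoticRank_coupling₃.trans_le h₁⟩))

-- `ω > 2 ⟹ R̃(C₁) > 4` is already in tree: `OutsiderSandwichCouplingBenchmark.four_lt_asymptoticRank_coupling₁_of_not_summit`.

/-! ## 4. Datum: `R̃(C₁) ≤ 6` -/

/-- **`R̃(C₁) ≤ 6`** (`R̃ ≤ R̲ = 6`), sharpening the tree's `R̃(C₁) ≤ 7`.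
[cite: BurgisserClausenShokrollahi1997, Lemma (15.27)] -/
theorem asymptoticRank_coupling₁_le_six : asymptoticRank coupling₁ ≤ 6 :=
  asymptoticRank_le_of_algBorderRank_le OutsiderSandwichBlockOneRank.algBorderRank_coupling₁.le

/-- **`R̃(C₁) ∈ [4, 6]`.** -/
theorem asymptoticRank_coupling₁_mem_Icc : asymptoticRank coupling₁ ∈ Set.Icc (4 : ℝ) 6 :=
  ⟨OutsiderSandwichBlockRank.four_le_asymptoticRank_coupling₁, asymptoticRank_coupling₁_le_six⟩

end Summit.MatrixMultiplication.MatrixMultiplication.Theorems.OutsiderSandwichBlockOneOperational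

end
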